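import Mathlib
import Literature.NumberTheory.Automorphic.QuotientRegularRepresentation
import HarnessLib

/-!
# The cocompact Haar model of `L²(G ⧸ Γ)` and the weighted toric period functional

Topic `NumberTheory/Automorphic`; namespace `Literature.NumberTheory.Automorphic.RegularRep`
(continuing `QuotientRegularRepresentation`).

* `IsCocompactHaarModel Γ μQ μ` : the standard set-up of `L²(Γ\G)` for a cocompact lattice as ONE
  named structural proposition — `μ` a regular Haar measure on `G`, right invariant as well
  (`G` unimodular), `Γ` countable, `G ⧸ Γ` compact, `μQ` the image of `μ` restricted to a
  fundamental domain of the right action of `Γ` [DeitmarEchterhoff2014, §1.5, §9.1];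
* `toricPeriodCLM ν w pt : C(Q, ℂ) →L[ℂ] ℂ`, `y ↦ ∫_T w(t) y(pt t) dν(t)` : the weighted toric
  period as a continuous linear functional on `C(Q, ℂ)` (`Q` compact, `w` continuous with compact
  support), with the bound `‖∫ w · y ∘ pt‖ ≤ ‖w‖_{L¹} ‖y‖`;
* the weight `wt β (star χ) = β · conj χ` and its conjugate;
* `inner_EisL2_toLp`, `conj_inner_EisL2_toLp` : the `L²(μQ)` pairing of a pseudo-Eisenstein vector
  `EisL2 … f` with (the class of) a continuous function `x` on the compact quotient is the integral
  `∫ conj(E^χ_f) · x dμQ` [Garrett2018, §1.8].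

Provenance: HodgeCM PerL cell `pub-hodgecm`, package files `HodgeCM/Automorphic/CocompactCarrier.lean`
§1 and `HodgeCM/Automorphic/UnfoldAnnihilation.lean` §§1–3 (seat pv15-g2, gate run 24), the
Mathlib-generic part; ported to the tree under the LEAN-IN-TREE rule by seat pv15-g7 (names
`HodgeCM.RegularRep.X` ↦ `Literature.NumberTheory.Automorphic.RegularRep.X`, statements verbatim).

## References

* A. Deitmar, S. Echterhoff, *Principles of Harmonic Analysis*, 2nd ed. (2014), §1.5, §9.1
  [DeitmarEchterhoff2014].
* P. Garrett, *Modern Analysis of Automorphic Forms by Example*, vol. 1 (2018), §1.8 [Garrett2018].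
-/

noncomputable section

open _root_.MeasureTheory Set Filter Function
open scoped InnerProductSpace ENNReal ComplexConjugate CompactlySupported

namespace Literature.NumberTheory.Automorphic

namespace RegularRep

open Literature.NumberTheory.Automorphic.PseudoEisenstein

/-! ## 0. The cocompact Haar model as one named structural proposition -/

section Model

variable {G : Type*} [Group G] [TopologicalSpace G] [MeasurableSpace G] (Γ : Subgroup G)
  [MeasurableSpace (G ⧸ Γ)] (μQ : Measure (G ⧸ Γ)) (μ : Measure G)

/-- **The cocompact Haar model of `L²(Γ\G)`** (structural data): `μ` a regular Haar measure on `G`,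
right-invariant as well (`G` unimodular); `Γ` countable; `G ⧸ Γ` compact; `μQ` the image of `μ`
restricted to a fundamental domain of the right action of `Γ`. (A predicate bundling HYPOTHESES
on `(Γ, μQ, μ)` — it is assumed, never asserted; concrete models discharge it, e.g. a discrete
cocompact subgroup of a unimodular group with `μQ` the quotient measure.)
[cite: DeitmarEchterhoff2014, §9.1] -/
structure IsCocompactHaarModel : Prop where
  isHaar : μ.IsHaarMeasure
  regular : μ.Regular
  rightInvariant : μ.IsMulRightInvariant
  countable : Countable Γ
  compactQuotient : CompactSpace (G ⧸ Γ)
  exists_fundamentalDomain : ∃ 𝓕 : Set G, IsFundamentalDomain Γ.op 𝓕 μ ∧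
    μQ = Measure.map (QuotientGroup.mk : G → G ⧸ Γ) (μ.restrict 𝓕)


end Model

section PeriodCLM

variable {T : Type*} [TopologicalSpace T] [MeasurableSpace T] [OpensMeasurableSpace T]
  (ν : Measure T) [IsFiniteMeasureOnCompacts ν]
  {Q : Type*} [TopologicalSpace Q] [CompactSpace Q]
  {w : T → ℂ} (hw : Continuous w) (hws : HasCompactSupport w) {pt : T → Q} (hpt : Continuous pt)

omit [CompactSpace Q] in
include hw hws hpt in
/-- `t ↦ w(t) y(pt t)` is integrable for `w` continuous with compact support. [folklore] -/
theorem integrable_mul_comp (y : C(Q, ℂ)) : Integrable (fun t => w t * y (pt t)) ν :=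
  (hw.mul (y.continuous.comp hpt)).integrable_of_hasCompactSupport hws.mul_right

include hw hws in
/-- `‖∫ w(t) y(pt t) dν‖ ≤ (∫ ‖w‖ dν) ‖y‖_∞`. [folklore] -/
theorem norm_integral_mul_comp_le (y : C(Q, ℂ)) :
    ‖∫ t, w t * y (pt t) ∂ν‖ ≤ (∫ t, ‖w t‖ ∂ν) * ‖y‖ := by
  have hwi : Integrable (fun t => ‖w t‖) ν := (hw.integrable_of_hasCompactSupport hws).norm
  calc ‖∫ t, w t * y (pt t) ∂ν‖ ≤ ∫ t, ‖w t‖ * ‖y‖ ∂ν := by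
        refine norm_integral_le_of_norm_le (hwi.mul_const _) (Eventually.of_forall fun t => ?_)
        rw [norm_mul]
        exact mul_le_mul_of_nonneg_left (y.norm_coe_le_norm (pt t)) (norm_nonneg _)
    _ = (∫ t, ‖w t‖ ∂ν) * ‖y‖ := integral_mul_const _ _

/-- **The weighted toric period** `y ↦ ∫_T w(t) y(pt t) dν(t)` as a continuous linear functional
on `C(Q, ℂ)` (`Q = G ⧸ Γ` compact, `w = β · conj χ` continuous with compact support,
`pt t = π (jT t)⁻¹`). [cite: Garrett2018, §1.8] -/
def toricPeriodCLM : C(Q, ℂ) →L[ℂ] ℂ :=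
  LinearMap.mkContinuous
    { toFun := fun y => ∫ t, w t * y (pt t) ∂ν
      map_add' := fun y z => by
        simp only [ContinuousMap.add_apply, mul_add]
        exact integral_add (integrable_mul_comp ν hw hws hpt y) (integrable_mul_comp ν hw hws hpt z)
      map_smul' := fun c y => by
        simp only [ContinuousMap.smul_apply, smul_eq_mul, RingHom.id_apply, ← integral_const_mul]
        congr 1
        ext t
        ring }
    (∫ t, ‖w t‖ ∂ν) (fun y => norm_integral_mul_comp_le ν hw hws y)

/-- Unfolding lemma for `toricPeriodCLM`. [folklore] -/
@[simp] theorem toricPeriodCLM_apply (y : C(Q, ℂ)) :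
    toricPeriodCLM ν hw hws hpt y = ∫ t, w t * y (pt t) ∂ν := rfl

end PeriodCLM

/-! ## 2. The weight `β · conj χ` -/

section Weight

variable {T : Type*} [TopologicalSpace T] (β : C_c(T, ℝ)) (χ : C(T, ℂ))

/-- `conj (β(t) conj χ(t)) = β(t) χ(t)`. [folklore] -/
theorem conj_wt_star (t : T) : conj (wt β (star χ) t) = wt β χ t := by
  simp only [wt, map_mul, Complex.conj_ofReal, Pi.star_apply, Complex.star_def, Complex.conj_conj]

/-- `β · conj χ` is continuous. [folklore] -/
theorem continuous_wt_star : Continuous (wt β (star χ)) :=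
  continuous_wt β.continuous (star χ).continuous

/-- `β · conj χ` has compact support. [folklore] -/
theorem hasCompactSupport_wt_star : HasCompactSupport (wt β (star χ)) :=
  (β.hasCompactSupport.comp_left Complex.ofReal_zero).mul_right

end Weight

/-! ## 3. `⟪E^χ_f, x⟫_{L²}` as an integral -/

section Unfold

variable {G : Type*} [Group G] [TopologicalSpace G] [IsTopologicalGroup G] [T2Space G]
  [LocallyCompactSpace G] [MeasurableSpace G] [BorelSpace G]
  {Γ : Subgroup G} [MeasurableSpace (G ⧸ Γ)] [BorelSpace (G ⧸ Γ)] [T2Space (G ⧸ Γ)]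
  [CompactSpace (G ⧸ Γ)]
  {μQ : Measure (G ⧸ Γ)} [IsFiniteMeasure μQ]
  {T : Type*} [Group T] [TopologicalSpace T] [T2Space T] [MeasurableSpace T] [OpensMeasurableSpace T]
  (ν : Measure T) [IsFiniteMeasureOnCompacts ν] (jT : ContinuousMonoidHom T G) (β : C_c(T, ℝ))
  (χ : C(T, ℂ))

omit [MeasurableSpace G] [BorelSpace G] [T2Space T] in
/-- `⟪E^χ_f, x⟫_{L²(μQ)} = ∫ conj(E^χ_f(q)) x(q) dμQ(q)` for a continuous `x` (a.e. representatives).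
[cite: Garrett2018, §1.8] -/
theorem inner_EisL2_toLp (hΓ : DiscreteMeets Γ) (f : C_c(G, ℂ)) (x : C(G ⧸ Γ, ℂ)) :
    ⟪EisL2 μQ ν jT β χ hΓ f, ContinuousMap.toLp (E := ℂ) 2 μQ ℂ x⟫_ℂ
      = ∫ q, conj (EisQ Γ ν jT.toMonoidHom β χ f q) * x q ∂μQ := by
  rw [MeasureTheory.L2.inner_def]
  refine integral_congr_ae ?_
  filter_upwards [coeFn_EisL2 μQ ν jT β χ hΓ f,
    ContinuousMap.coeFn_toLp (E := ℂ) (p := 2) (μ := μQ) (𝕜 := ℂ) x] with q h1 h2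
  rw [RCLike.inner_apply', h1, h2]

omit [MeasurableSpace G] [BorelSpace G] [T2Space T] in
/-- The conjugate pairing: `conj ⟪E^χ_f, x⟫ = ∫ conj(x(q)) E^χ_f(q) dμQ(q)`. [folklore] -/
theorem conj_inner_EisL2_toLp (hΓ : DiscreteMeets Γ) (f : C_c(G, ℂ)) (x : C(G ⧸ Γ, ℂ)) :
    conj ⟪EisL2 μQ ν jT β χ hΓ f, ContinuousMap.toLp (E := ℂ) 2 μQ ℂ x⟫_ℂ
      = ∫ q, conj (x q) * EisQ Γ ν jT.toMonoidHom β χ f q ∂μQ := by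
  rw [inner_EisL2_toLp, ← integral_conj]
  congr 1
  ext q
  simp only [map_mul, RingHomCompTriple.comp_apply, RingHom.id_apply, mul_comm]

end Unfold

end RegularRep

end Literature.NumberTheory.Automorphic

end
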